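import Mathlib
import Literature.Analysis.Complex.CauchyPompeiu
import Literature.Analysis.Complex.CauchyTransform
import Literature.Analysis.Complex.CauchyTransformBounds
import Literature.Analysis.Complex.WeylLemmaDbar
import HarnessLib

/-!
# The `δ`-regularisation device for the similarity principle

Toolbox for the smooth-category proof of the Carleman–Bers–Vekua similarity principle
(`Literature/Analysis/Complex/SimilarityPrinciple.lean`; Wendl (2020), App. B, Thm B.20;
McDuff–Salamon (2012), §2.3). Classically a function `w` with `∂̄ w = r`, `|r| ≤ M |w|`, is written
`w = e^{s} h` with `h` holomorphic by solving `∂̄ s = r / w`; the coefficient `r / w` is bounded but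
discontinuous at the zeros of `w`, which forces `L^p`/Sobolev theory. The device recorded here
stays inside `C^∞`: for `δ > 0` the **regularised coefficient**
`a_δ := r · conj w / (|w|² + δ)` is smooth, bounded by `M` uniformly in `δ`, and `a_δ w`
approximates `r` up to `M √δ / 2`; its Cauchy transform `s = T a_δ` is a smooth potential
(`∂̄ s = a_δ`, `‖s‖ ≤ S` on discs), and `h := e^{-s} w` has the same zeros as `w` and
`‖∂̄ h‖ = ‖e^{-s} (r - a_δ w)‖ ≤ e^{S} M √δ / 2`, i.e. is approximately holomorphic.

## Contents (namespace `Literature.Analysis.Complex.Similarity`)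

* `denom_pos`, `contDiff_coeff`, `hasCompactSupport_coeff`, `norm_coeff_le`, `sub_coeff_mul`,
  `norm_sub_coeff_mul_le`, `regularisedCoefficient` (the package): properties of `a_δ`;
* `dbarAlong_one_cexp`, `dbarAlong_one_exp_neg_mul`: `∂̄ (e^{-s} G) = e^{-s} (∂̄ G - ∂̄ s · G)`;
* `norm_exp_neg_le`, `exp_neg_le_norm_exp_neg`: `e^{-S} ≤ |e^{-w}| ≤ e^{S}` for `|w| ≤ S`;
* `norm_cauchyTransform_le_of_bound`, `exists_potential`: the potential `s = T a` with sup bound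
  (from `Literature.Analysis.Complex.norm_cauchyTransformAlong_le`).

Provenance: these lemmas were first written for the crux `TameOrBrodyR4` of summit
`SmoothPoincare4` (`Theorems/SullivanDualTameOrBrodyR4Helper{RegularisedCoefficient,ZeroFreeOfDbarLe}.lean`)
and are re-homed here as general complex analysis (promotion event 3639839).

## References

* C. Wendl, *Lectures on Contact 3-Manifolds, Holomorphic Curves and Intersection Theory* (2020),
  App. B.1, Thm B.20 (similarity principle). [Wendl2020]
* D. McDuff, D. Salamon, *J-holomorphic curves and symplectic topology*, 2nd ed. (2012), §2.3
  (Carleman similarity principle). [McDuffSalamon2012]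
-/

noncomputable section

open scoped ContDiff ComplexConjugate Topology
open Filter Set Metric

namespace Literature.Analysis.Complex

namespace Similarity

/-! ### The regularised coefficient `a_δ = r · conj G / (|G|² + δ)` -/

/-- The regularising denominator `‖z‖² + δ` is positive. [folklore] -/
theorem denom_pos (z : ℂ) {δ : ℝ} (hδ : 0 < δ) : 0 < ‖z‖ ^ 2 + δ := by positivity

/-- The regularising denominator, cast to `ℂ`, is nonzero. [folklore] -/
theorem denom_ne_zero (z : ℂ) {δ : ℝ} (hδ : 0 < δ) : (((‖z‖ ^ 2 + δ : ℝ)) : ℂ) ≠ 0 :=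
  Complex.ofReal_ne_zero.2 (denom_pos z hδ).ne'

/-- Smoothness of `η ↦ ((‖G η‖² + δ : ℝ) : ℂ)`. [folklore] -/
theorem contDiff_denom (G : ℂ → ℂ) (δ : ℝ) (hG : ContDiff ℝ ∞ G) :
    ContDiff ℝ ∞ (fun η => (((‖G η‖ ^ 2 + δ : ℝ)) : ℂ)) := by
  have h1 : ContDiff ℝ ∞ (fun η => ‖G η‖ ^ 2 + δ) :=
    ((contDiff_norm_sq ℝ).comp hG).add contDiff_const
  exact Complex.ofRealCLM.contDiff.comp h1

/-- Smoothness of the regularised coefficient. [folklore] -/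
theorem contDiff_coeff (G r : ℂ → ℂ) (δ : ℝ) (hδ : 0 < δ)
    (hG : ContDiff ℝ ∞ G) (hr : ContDiff ℝ ∞ r) :
    ContDiff ℝ ∞ (fun η => r η * conj (G η) / (((‖G η‖ ^ 2 + δ : ℝ)) : ℂ)) := by
  have hconj : ContDiff ℝ ∞ (fun η => conj (G η)) := Complex.conjCLE.contDiff.comp hG
  have hinv : ContDiff ℝ ∞ (fun η => ((((‖G η‖ ^ 2 + δ : ℝ)) : ℂ))⁻¹) :=
    (contDiff_denom G δ hG).inv fun η => denom_ne_zero (G η) hδ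
  simpa only [div_eq_mul_inv] using (hr.mul hconj).mul hinv

/-- The regularised coefficient vanishes wherever `r` does, hence has compact support. [folklore] -/
theorem hasCompactSupport_coeff (G r : ℂ → ℂ) (ρ₀ δ : ℝ)
    (hsupp : ∀ η : ℂ, ρ₀ ≤ ‖η‖ → r η = 0) :
    HasCompactSupport (fun η => r η * conj (G η) / (((‖G η‖ ^ 2 + δ : ℝ)) : ℂ)) := by
  refine HasCompactSupport.intro (isCompact_closedBall (0 : ℂ) ρ₀) fun η hη => ?_
  have hρ : ρ₀ ≤ ‖η‖ := by
    rw [Metric.mem_closedBall, dist_zero_right, not_le] at hη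
    exact hη.le
  simp [hsupp η hρ]

/-- Norm of the regularised coefficient. [folklore] -/
theorem norm_coeff (G r : ℂ → ℂ) (δ : ℝ) (hδ : 0 < δ) (η : ℂ) :
    ‖r η * conj (G η) / (((‖G η‖ ^ 2 + δ : ℝ)) : ℂ)‖ =
      ‖r η‖ * ‖G η‖ / (‖G η‖ ^ 2 + δ) := by
  rw [norm_div, norm_mul, Complex.norm_conj, Complex.norm_of_nonneg (denom_pos (G η) hδ).le]

/-- The uniform bound `‖a_δ‖ ≤ M`. [folklore] -/
theorem norm_coeff_le (G r : ℂ → ℂ) (M δ : ℝ) (hM : 0 ≤ M) (hδ : 0 < δ)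
    (hbound : ∀ η, ‖r η‖ ≤ M * ‖G η‖) (η : ℂ) :
    ‖r η * conj (G η) / (((‖G η‖ ^ 2 + δ : ℝ)) : ℂ)‖ ≤ M := by
  rw [norm_coeff G r δ hδ η, div_le_iff₀ (denom_pos (G η) hδ)]
  calc ‖r η‖ * ‖G η‖ ≤ M * ‖G η‖ * ‖G η‖ :=
        mul_le_mul_of_nonneg_right (hbound η) (norm_nonneg _)
    _ ≤ M * (‖G η‖ ^ 2 + δ) := by nlinarith [mul_nonneg hM hδ.le]

/-- The key algebraic identity `r - a_δ G = r δ / (|G|² + δ)`. [folklore] -/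
theorem sub_coeff_mul (G r : ℂ → ℂ) (δ : ℝ) (hδ : 0 < δ) (η : ℂ) :
    r η - r η * conj (G η) / (((‖G η‖ ^ 2 + δ : ℝ)) : ℂ) * G η =
      r η * (δ : ℂ) / (((‖G η‖ ^ 2 + δ : ℝ)) : ℂ) := by
  set N : ℂ := (((‖G η‖ ^ 2 + δ : ℝ)) : ℂ) with hN
  have hne : N ≠ 0 := denom_ne_zero (G η) hδ
  have hkey : conj (G η) * G η = N - δ := by
    rw [Complex.conj_mul', hN]
    push_cast
    ring
  have hu : N * N⁻¹ = 1 := mul_inv_cancel₀ hne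
  simp only [div_eq_mul_inv]
  linear_combination (-r η) * hu - (r η * N⁻¹) * hkey

/-- AM–GM in the form `|G| δ ≤ (√δ / 2) (|G|² + δ)`. [folklore] -/
theorem mul_le_sqrt_half_mul (g δ : ℝ) (hg : 0 ≤ g) (hδ : 0 < δ) :
    g * δ ≤ Real.sqrt δ / 2 * (g ^ 2 + δ) := by
  have hs : Real.sqrt δ ^ 2 = δ := Real.sq_sqrt hδ.le
  have h0 : 0 ≤ Real.sqrt δ * (g - Real.sqrt δ) ^ 2 :=
    mul_nonneg (Real.sqrt_nonneg δ) (sq_nonneg _)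
  nlinarith [h0, hs, hg, Real.sqrt_nonneg δ]

/-- The approximation bound `‖r - a_δ G‖ ≤ M √δ / 2`. [folklore] -/
theorem norm_sub_coeff_mul_le (G r : ℂ → ℂ) (M δ : ℝ) (hM : 0 ≤ M) (hδ : 0 < δ)
    (hbound : ∀ η, ‖r η‖ ≤ M * ‖G η‖) (η : ℂ) :
    ‖r η - r η * conj (G η) / (((‖G η‖ ^ 2 + δ : ℝ)) : ℂ) * G η‖ ≤ M * Real.sqrt δ / 2 := by
  have hNpos := denom_pos (G η) hδ
  rw [sub_coeff_mul G r δ hδ η, norm_div, norm_mul, Complex.norm_of_nonneg hδ.le,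
    Complex.norm_of_nonneg hNpos.le, div_le_iff₀ hNpos]
  calc ‖r η‖ * δ ≤ M * ‖G η‖ * δ := mul_le_mul_of_nonneg_right (hbound η) hδ.le
    _ = M * (‖G η‖ * δ) := by ring
    _ ≤ M * (Real.sqrt δ / 2 * (‖G η‖ ^ 2 + δ)) :=
        mul_le_mul_of_nonneg_left (mul_le_sqrt_half_mul ‖G η‖ δ (norm_nonneg _) hδ) hM
    _ = M * Real.sqrt δ / 2 * (‖G η‖ ^ 2 + δ) := by ring

/-- **The `δ`-regularised coefficient, packaged.** For smooth `G`, `r` with `|r| ≤ M |G|` and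
`r = 0` for `‖η‖ ≥ ρ₀`, the coefficient `a_δ := r · conj G / (|G|² + δ)` is smooth, compactly
supported, bounded by `M` uniformly in `δ`, and `a_δ G` approximates `r` up to `M √δ / 2`. [folklore] -/
theorem regularisedCoefficient (G r : ℂ → ℂ) (M ρ₀ δ : ℝ) (hM : 0 ≤ M) (hδ : 0 < δ)
    (hG : ContDiff ℝ ∞ G) (hr : ContDiff ℝ ∞ r)
    (hbound : ∀ η, ‖r η‖ ≤ M * ‖G η‖) (hsupp : ∀ η : ℂ, ρ₀ ≤ ‖η‖ → r η = 0) :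
    ContDiff ℝ ∞ (fun η => r η * conj (G η) / (((‖G η‖ ^ 2 + δ : ℝ)) : ℂ)) ∧
    HasCompactSupport (fun η => r η * conj (G η) / (((‖G η‖ ^ 2 + δ : ℝ)) : ℂ)) ∧
    (∀ η, ‖r η * conj (G η) / (((‖G η‖ ^ 2 + δ : ℝ)) : ℂ)‖ ≤ M) ∧
    (∀ η, ‖r η - r η * conj (G η) / (((‖G η‖ ^ 2 + δ : ℝ)) : ℂ) * G η‖ ≤
      M * Real.sqrt δ / 2) :=
  ⟨contDiff_coeff G r δ hδ hG hr, hasCompactSupport_coeff G r ρ₀ δ hsupp,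
    fun η => norm_coeff_le G r M δ hM hδ hbound η,
    fun η => norm_sub_coeff_mul_le G r M δ hM hδ hbound η⟩

/-! ### Calculus of `∂̄` for `exp (-s) · G` -/

/-- Chain rule for `∂̄` with the holomorphic outer function `exp`:
`∂̄ (exp ∘ u) = (exp ∘ u) · ∂̄ u` for real-differentiable `u`. [folklore] -/
theorem dbarAlong_one_cexp {u : ℂ → ℂ} {z : ℂ} (hu : DifferentiableAt ℝ u z) :
    dbarAlong 1 (fun w => Complex.exp (u w)) z = Complex.exp (u z) * dbarAlong 1 u z := by
  rw [dbarAlong_one, dbarAlong_one, hu.hasFDerivAt.cexp.fderiv]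
  simp only [FunLike.coe_smul, Pi.smul_apply, smul_eq_mul]
  ring

/-- `∂̄ (-u) = -∂̄ u`. [folklore] -/
theorem dbarAlong_one_neg (u : ℂ → ℂ) (z : ℂ) :
    dbarAlong 1 (fun w => -u w) z = -dbarAlong 1 u z := by
  rw [dbarAlong_one, dbarAlong_one, fderiv_fun_neg]
  simp only [_root_.neg_apply, smul_eq_mul]
  ring

/-- The Leibniz–chain rule `∂̄ (e^{-s} G) = e^{-s} (∂̄ G - ∂̄ s · G)`. [folklore] -/
theorem dbarAlong_one_exp_neg_mul {s G : ℂ → ℂ} {z : ℂ} (hs : DifferentiableAt ℝ s z)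
    (hG : DifferentiableAt ℝ G z) :
    dbarAlong 1 (fun w => Complex.exp (-s w) * G w) z =
      Complex.exp (-s z) * (dbarAlong 1 G z - dbarAlong 1 s z * G z) := by
  rw [dbarAlong_one_mul (a := fun w => Complex.exp (-s w)) hs.fun_neg.cexp hG,
    dbarAlong_one_cexp hs.fun_neg, dbarAlong_one_neg]
  ring

/-! ### Size of `exp (-w)` for `‖w‖ ≤ S` -/

/-- Upper bound `‖exp (-w)‖ ≤ e^S` for `‖w‖ ≤ S`. [folklore] -/
theorem norm_exp_neg_le {w : ℂ} {S : ℝ} (h : ‖w‖ ≤ S) : ‖Complex.exp (-w)‖ ≤ Real.exp S := by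
  rw [Complex.norm_exp, Real.exp_le_exp, Complex.neg_re]
  have h1 := Complex.abs_re_le_norm w
  have h2 := neg_abs_le w.re
  linarith

/-- Lower bound `e^{-S} ≤ ‖exp (-w)‖` for `‖w‖ ≤ S`. [folklore] -/
theorem exp_neg_le_norm_exp_neg {w : ℂ} {S : ℝ} (h : ‖w‖ ≤ S) :
    Real.exp (-S) ≤ ‖Complex.exp (-w)‖ := by
  rw [Complex.norm_exp, Real.exp_le_exp, Complex.neg_re]
  have h1 := Complex.re_le_norm w
  linarith

/-! ### The potential `s = T a` -/

/-- **Sup bound for the Cauchy transform** of a density bounded by `M` and vanishing where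
`ρ₀ ≤ ‖z‖`: `‖(T a)(w)‖ ≤ 2 (ρ + ρ₀) M` for `‖w‖ ≤ ρ`. [folklore] -/
theorem norm_cauchyTransform_le_of_bound {a : ℂ → ℂ} {ρ₀ ρ M : ℝ} (hρ₀ : 0 ≤ ρ₀) (hρ : 0 ≤ ρ)
    (hM : 0 ≤ M) (ha0 : ∀ z : ℂ, ρ₀ ≤ ‖z‖ → a z = 0) (haM : ∀ z, ‖a z‖ ≤ M) {w : ℂ}
    (hw : ‖w‖ ≤ ρ) : ‖cauchyTransformAlong 1 a w‖ ≤ 2 * (ρ + ρ₀) * M := by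
  refine norm_cauchyTransformAlong_le (by linarith) hM (fun t ht => ?_) (fun t => ?_)
  · rw [smul_eq_mul, mul_one] at ht
    have h1 : ‖w - t‖ < ρ₀ := lt_of_not_ge fun h => ht (ha0 _ h)
    have h2 : ‖t‖ ≤ ‖w‖ + ‖w - t‖ := by
      have := norm_sub_le w (w - t)
      rwa [sub_sub_cancel] at this
    linarith
  · rw [smul_eq_mul, mul_one]
    exact haM _

/-- **The potential.** For a smooth compactly supported density `a` with `‖a‖ ≤ M` vanishing
where `ρ₀ ≤ ‖z‖`, the Cauchy transform `s = T a` is smooth, solves `∂̄ s = a`, and satisfies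
`‖s‖ ≤ 2 (ρ + ρ₀) M` on `‖z‖ ≤ ρ`. [folklore] -/
theorem exists_potential {a : ℂ → ℂ} {ρ₀ ρ M : ℝ} (hρ₀ : 0 ≤ ρ₀) (hρ : 0 ≤ ρ) (hM : 0 ≤ M)
    (ha : ContDiff ℝ ∞ a) (hac : HasCompactSupport a) (haM : ∀ z, ‖a z‖ ≤ M)
    (ha0 : ∀ z : ℂ, ρ₀ ≤ ‖z‖ → a z = 0) :
    ∃ s : ℂ → ℂ, ContDiff ℝ ∞ s ∧ (∀ z, dbarAlong 1 s z = a z) ∧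
      ∀ z : ℂ, ‖z‖ ≤ ρ → ‖s z‖ ≤ 2 * (ρ + ρ₀) * M :=
  ⟨cauchyTransformAlong 1 a, contDiff_cauchyTransformAlong ha hac one_ne_zero,
    dbarAlong_cauchyTransformAlong (ha.of_le (by exact_mod_cast le_top)) hac one_ne_zero,
    fun _ hz => norm_cauchyTransform_le_of_bound hρ₀ hρ hM ha0 haM hz⟩

end Similarity

end Literature.Analysis.Complex

end
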